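import Literature.Probability.Process.MatrixRenewalPiecesSecondMoment
import HarnessLib

/-!
# The second moment of an additive reward along a critical matrix renewal pair: `S₂(m)_{ab}/((m+1)² D(m)_{ab}) → θ²` — the reward per unit
# length has asymptotically vanishing variance (module «MATRIX-RENEWAL-REWARD-VARIANCE»)

Topic `Literature/Probability/Process` (renewal theory; continues «MATRIX-RENEWAL-PIECES-LLN» `MatrixRenewalPiecesSecondMoment.lean` — the weighted Cesàro
lemma `tendsto_antidiagonal_mul_div_sq`, `serG_mul_one_sub_serM`, and the piece-count case `tendsto_Q_div_sq_D` — and «MATRIX-RENEWAL-REWARD»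
`MatrixRenewalReward.lean`: `RewardPair K` (`S₁ = R₁ + R₁∗D + M∗S₁`), `RewardPair.tendsto_S_div` (`S₁(m)/(m+1) → L R̄₁ L`), `RewardPair.tendsto_S_div_D`
(`θ = (Σ_{c,d} L_{oc}R̄_{cd}L_{do})/L_{oo}`), `RewardPair.tendsto_G_of_critical`; `Critical.L_mul_L_eq` (rank one); `Renewal.tendsto_sum_antidiagonal_mul`).
Lane «pcv-sawmu» (CriticalPhenomena venture), a-p2 g24 — the abstract half of the strip's «CONTACT-LLN».  Sources of the TEMPLATE: W. Feller I (1968)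
XIII.6 (mean and variance of the number of renewals by the renewal argument), XIII.3; E. Seneta (1973) §6.2.  The arrangement (a squared-reward sequence
`S₂` tied to the reward pair by `S₂ = R₂ + R₂∗D + 2R₁∗S₁ + M∗S₂`, solved as `S₂ = G R₂ G + 2 G R₁ S₁`) is the lane's; nothing is quoted.

## What is proved (namespace `Literature.Probability.Process.RenewalKernelPair`; `K.Critical L` throughout; `R̄ = Σ_j R₁(j)`)

* §1 ★ `Critical.tendsto_cf_serG_mul_mk` — `(G∗R)(i)_{ac} → Σ_d L_{ad} R̄_{dc}` for any summable `R ≥ 0`.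
* §2 ★★ `S2_eq_conv` — for a reward pair `(R₁, S₁)` and sequences `R₂, S₂` with `S₂(m) = R₂(m) + Σ_{i+j=m}(R₂(i)D(j) + 2R₁(i)S₁(j) + M(i)S₂(j))`
  (the recursion of the SQUARED additive reward: `(r₁ + r')² = r₁² + 2r₁r' + r'²`):
  `S₂(m)_{ab} = Σ_{i+j=m}Σ_c (G∗R₂)(i)_{ac}G(j)_{cb} + Σ_{i+j=m}Σ_c (G∗R₁)(i)_{ac}·2S₁(j)_{cb}`;
  ★★★ `tendsto_S2_div_sq` — `S₂(m)_{ab}/(m+1)² → (L R̄ L R̄ L)_{ab}` (`R₂ ≥ 0` summable: the `G R₂ G` part grows only linearly);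
  `Critical.LRLRL_eq` (rank one: `(L R̄ L R̄ L)_{ab} = L_{ab}·θ²`);
  ★★★★ `tendsto_S2_div_sq_D` — **`S₂(m)_{ab}/((m+1)² D(m)_{ab}) → θ²`**: the second moment of (reward)/(length) converges to the SQUARE of the
  renewal–reward density, every pair of levels — so the variance of the reward density is `o(1)` (weak law by Chebyshev on the user's explicit sums;
  done for the surface contacts of the honeycomb strip in `RandomPlanarGeometry/HexSAWStripBridgeContactLLN.lean`).

Label: CLASSICAL TEMPLATE (Feller XIII.6) in the lane's matrix / pointwise ARRANGEMENT (own proof route; a-p2 g24, 2026-08-27).  NOT claimed: a CLT, the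
linear term of the variance, rewards without a finite second one-piece moment, periodic / null-recurrent pairs.
-/

noncomputable section

open Finset Filter Topology Matrix PowerSeries Literature.Analysis.Matrix

namespace Literature.Probability.Process

namespace RenewalKernelPair

variable {ι : Type*} [Fintype ι] [DecidableEq ι] {K : RenewalKernelPair ι} {L : ι → ι → ℝ}

/-! ### §1 `(G ∗ R)(i) → L R̄` for a summable non-negative one-piece reward -/

/-- `Σ_{k+j=i} Σ_d G(k)_{ad} R(j)_{dc} → Σ_d L_{ad} R̄_{dc}` (`R ≥ 0` summable; «convergent ∗ summable»). [cite: Feller1968, XIII.6; Seneta1973, §6.2; lane «pcv-sawmu» a-p2 g24] -/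
theorem Critical.tendsto_cf_serG_mul_mk (h : K.Critical L) {R : ℕ → Matrix ι ι ℝ} (hR : ∀ j a b, 0 ≤ R j a b)
    (hsR : ∀ a b, Summable fun j => R j a b) (a c : ι) :
    Tendsto (fun i : ℕ => cf i (K.serG * PowerSeries.mk R) a c) atTop (𝓝 (∑ d, L a d * ∑' j : ℕ, R j d c)) := by
  have hlim : Tendsto (fun i : ℕ => ∑ d, ∑ q ∈ antidiagonal i, R q.1 d c * K.G q.2 a d) atTop
      (𝓝 (∑ d, (∑' j : ℕ, R j d c) * L a d)) := by
    refine tendsto_finsetSum _ fun d _ => ?_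
    have hG := RewardPair.tendsto_G_of_critical h a d
    obtain ⟨B, hB⟩ := hG.bddAbove_range
    have hGB : ∀ n, |K.G n a d| ≤ B := fun n => by rw [abs_of_nonneg (K.G_nonneg n a d)]; exact hB ⟨n, rfl⟩
    exact Renewal.tendsto_sum_antidiagonal_mul (g := fun j => R j d c) (u := fun n => K.G n a d)
      (fun j => hR j d c) (hsR d c) hGB hG
  have hval : ∑ d, (∑' j : ℕ, R j d c) * L a d = ∑ d, L a d * ∑' j : ℕ, R j d c := sum_congr rfl fun d _ => mul_comm _ _
  rw [hval] at hlim
  refine hlim.congr fun i => ?_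
  rw [cf_mul, sum_comm, ← Finset.Nat.sum_antidiagonal_swap]
  refine sum_congr rfl fun q _ => sum_congr rfl fun d _ => ?_
  simp only [Prod.fst_swap, Prod.snd_swap, cf_mk]
  rw [mul_comm]
  rfl

/-! ### §2 The second-moment recursion solved: `S₂ = G R₂ G + 2·G R₁ S₁`, and its growth -/

/-- ★★ **THE SECOND-MOMENT RECURSION SOLVED.**  Let `(R₁, S₁)` be a reward pair over `K` (`S₁ = R₁ + R₁∗D + M∗S₁`: the total reward) and let
`R₂(j), S₂(m)` satisfy `S₂(m) = R₂(m) + Σ_{i+j=m}(R₂(i)D(j) + 2R₁(i)S₁(j) + M(i)S₂(j))` — the recursion of the SQUARED reward (for an additive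
reward `r = r(first piece) + r(rest)`: `r² = r₁² + 2r₁r' + r'²`, so `R₂(j) = Σ_{pieces of length j} r²·weight` and `S₂ = Σ r²·weight`).  Then
`S₂(m)_{ab} = Σ_{i+j=m} Σ_c (G∗R₂)(i)_{ac} G(j)_{cb} + Σ_{i+j=m} Σ_c (G∗R₁)(i)_{ac} · 2S₁(j)_{cb}` (`S₂ = G R₂ G + 2 G R₁ S₁` as power series).
[cite: Feller1968, XIII.6 (second moments by the renewal argument); lane «pcv-sawmu» a-p2 g24 — own arrangement] -/
theorem S2_eq_conv (W : RewardPair K) (R₂ S₂ : ℕ → Matrix ι ι ℝ)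
    (renS₂ : ∀ m, S₂ m = R₂ m + ∑ p ∈ antidiagonal m, (R₂ p.1 * K.D p.2 + (2 : ℝ) • (W.R p.1 * W.S p.2) + K.M p.1 * S₂ p.2))
    (m : ℕ) (a b : ι) :
    S₂ m a b = (∑ p ∈ antidiagonal m, ∑ c, cf p.1 (K.serG * PowerSeries.mk R₂) a c * K.G p.2 c b) +
      ∑ p ∈ antidiagonal m, ∑ c, cf p.1 (K.serG * PowerSeries.mk W.R) a c * (2 * W.S p.2 c b) := by
  set S' : ℕ → Matrix ι ι ℝ := fun m => (2 : ℝ) • W.S m with hS'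
  -- the recursion as a power-series identity: `S₂ = R₂·G + R₁·S' + M·S₂`
  have hG : ∀ j, coeff j K.serG = (if j = 0 then (1 : Matrix ι ι ℝ) else 0) + K.D j := fun j => by
    rw [RenewalKernelPair.serG, map_add, PowerSeries.coeff_one, coeff_mk]
  have hser : PowerSeries.mk S₂ = PowerSeries.mk R₂ * K.serG + PowerSeries.mk W.R * PowerSeries.mk S' + K.serM * PowerSeries.mk S₂ := by
    refine PowerSeries.ext fun m => ?_
    rw [coeff_mk, map_add, map_add, PowerSeries.coeff_mul, PowerSeries.coeff_mul, PowerSeries.coeff_mul, renS₂ m]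
    simp only [hG, coeff_mk, coeff_serM, mul_add, sum_add_distrib]
    have h1 : ∑ p ∈ antidiagonal m, R₂ p.1 * (if p.2 = 0 then (1 : Matrix ι ι ℝ) else 0) = R₂ m := by
      rw [Finset.sum_eq_single (m, 0)]
      · simp
      · intro p hp hne
        have hp' := HasAntidiagonal.mem_antidiagonal.mp hp
        have : p.2 ≠ 0 := fun h0 => hne (by ext <;> simp <;> omega)
        simp [this]
      · intro h; exact absurd (HasAntidiagonal.mem_antidiagonal.mpr (by simp)) h
    rw [h1, hS']
    simp only [Matrix.mul_smul]
    abel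
  have h1 : (1 - K.serM) * PowerSeries.mk S₂ = PowerSeries.mk R₂ * K.serG + PowerSeries.mk W.R * PowerSeries.mk S' := by
    rw [sub_mul, one_mul]
    nth_rewrite 1 [hser]
    abel
  have hS₂ : PowerSeries.mk S₂ = K.serG * PowerSeries.mk R₂ * K.serG + K.serG * PowerSeries.mk W.R * PowerSeries.mk S' := by
    calc PowerSeries.mk S₂ = (K.serG * (1 - K.serM)) * PowerSeries.mk S₂ := by rw [serG_mul_one_sub_serM, one_mul]
      _ = K.serG * ((1 - K.serM) * PowerSeries.mk S₂) := by rw [mul_assoc]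
      _ = K.serG * (PowerSeries.mk R₂ * K.serG + PowerSeries.mk W.R * PowerSeries.mk S') := by rw [h1]
      _ = _ := by rw [mul_add, mul_assoc, mul_assoc]
  have h := congr_arg (fun F => cf m F a b) hS₂
  simp only [cf_mk] at h
  rw [h, cf_add, cf_mul, cf_mul]
  have e2 : ∀ (p : ℕ × ℕ) (c : ι), cf p.2 (PowerSeries.mk S') c b = 2 * W.S p.2 c b := fun p c => by
    rw [cf_mk, hS']
    simp only [Matrix.smul_apply, smul_eq_mul]
  simp_rw [e2]
  rfl

/-- ★★★ **SECOND MOMENT, POINTWISE**: under `K.Critical L`, with `(R₁, S₁)` a reward pair, `R₂ ≥ 0` summable (finite second moment of the one-piece reward)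
and `S₂` as in `S2_eq_conv`: `S₂(m)_{ab}/(m+1)² → Σ_c (L R̄₁)_{ac} (L R̄₁ L)_{cb} = (L R̄₁ L R̄₁ L)_{ab}` — the `G R₂ G` part grows only linearly.
[cite: Feller1968, XIII.6; Seneta1973, §6.2; lane «pcv-sawmu» a-p2 g24 — own arrangement] -/
theorem tendsto_S2_div_sq (h : K.Critical L) (W : RewardPair K) (R₂ S₂ : ℕ → Matrix ι ι ℝ) (hR₂ : ∀ j a b, 0 ≤ R₂ j a b)
    (hsR₂ : ∀ a b, Summable fun j => R₂ j a b)
    (renS₂ : ∀ m, S₂ m = R₂ m + ∑ p ∈ antidiagonal m, (R₂ p.1 * K.D p.2 + (2 : ℝ) • (W.R p.1 * W.S p.2) + K.M p.1 * S₂ p.2)) (a b : ι) :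
    Tendsto (fun m : ℕ => S₂ m a b / ((m : ℝ) + 1) ^ 2) atTop
      (𝓝 (∑ c, (∑ d, L a d * ∑' j : ℕ, W.R j d c) * ∑ d, (∑ e, L c e * ∑' j : ℕ, W.R j e d) * L d b)) := by
  -- first part: `(G R₂ G)(m)/(m+1)² → 0`
  have hA : Tendsto (fun m : ℕ => (∑ p ∈ antidiagonal m, ∑ c, cf p.1 (K.serG * PowerSeries.mk R₂) a c * K.G p.2 c b) / ((m : ℝ) + 1) ^ 2)
      atTop (𝓝 0) := by
    have hGz : ∀ c, Tendsto (fun j : ℕ => K.G j c b / ((j : ℝ) + 1)) atTop (𝓝 0) := fun c => by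
      have hG := RewardPair.tendsto_G_of_critical h c b
      have : Tendsto (fun j : ℕ => K.G j c b * (1 / ((j : ℝ) + 1))) atTop (𝓝 (L c b * 0)) :=
        hG.mul (tendsto_const_nhds.div_atTop (tendsto_natCast_atTop_atTop.atTop_add tendsto_const_nhds))
      rw [mul_zero] at this
      refine this.congr fun j => ?_
      ring
    have h0 : Tendsto (fun m : ℕ => ∑ c, (∑ p ∈ antidiagonal m, cf p.1 (K.serG * PowerSeries.mk R₂) a c * K.G p.2 c b) / ((m : ℝ) + 1) ^ 2)
        atTop (𝓝 (∑ c, (∑ d, L a d * ∑' j : ℕ, R₂ j d c) * 0 / 2)) :=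
      tendsto_finsetSum _ fun c _ =>
        tendsto_antidiagonal_mul_div_sq (x := fun i : ℕ => cf i (K.serG * PowerSeries.mk R₂) a c) (y := fun j : ℕ => K.G j c b)
          (h.tendsto_cf_serG_mul_mk hR₂ hsR₂ a c) (hGz c)
    simp only [mul_zero, zero_div, sum_const_zero] at h0
    refine h0.congr fun m => ?_
    rw [Finset.sum_div]
    simp only [Finset.sum_div]
    exact Finset.sum_comm
  -- second part: `2 (G R₁ S₁)(m)/(m+1)² → (L R̄₁)(L R̄₁ L)`
  have hS : ∀ c, Tendsto (fun j : ℕ => 2 * W.S j c b / ((j : ℝ) + 1)) atTop (𝓝 (2 * ∑ d, (∑ e, L c e * ∑' j : ℕ, W.R j e d) * L d b)) :=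
    fun c => by
      have := (W.tendsto_S_div h c b).const_mul 2
      refine this.congr fun j => ?_
      ring
  have hB : Tendsto (fun m : ℕ => (∑ p ∈ antidiagonal m, ∑ c, cf p.1 (K.serG * PowerSeries.mk W.R) a c * (2 * W.S p.2 c b)) /
      ((m : ℝ) + 1) ^ 2) atTop (𝓝 (∑ c, (∑ d, L a d * ∑' j : ℕ, W.R j d c) * ∑ d, (∑ e, L c e * ∑' j : ℕ, W.R j e d) * L d b)) := by
    have h0 : Tendsto (fun m : ℕ => ∑ c, (∑ p ∈ antidiagonal m, cf p.1 (K.serG * PowerSeries.mk W.R) a c * (2 * W.S p.2 c b)) / ((m : ℝ) + 1) ^ 2)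
        atTop (𝓝 (∑ c, (∑ d, L a d * ∑' j : ℕ, W.R j d c) * (2 * ∑ d, (∑ e, L c e * ∑' j : ℕ, W.R j e d) * L d b) / 2)) :=
      tendsto_finsetSum _ fun c _ =>
        tendsto_antidiagonal_mul_div_sq (x := fun i : ℕ => cf i (K.serG * PowerSeries.mk W.R) a c) (y := fun j : ℕ => 2 * W.S j c b)
          (h.tendsto_cf_serG_mul_mk W.R_nonneg W.summable_R a c) (hS c)
    have hval : ∑ c, (∑ d, L a d * ∑' j : ℕ, W.R j d c) * (2 * ∑ d, (∑ e, L c e * ∑' j : ℕ, W.R j e d) * L d b) / 2 =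
        ∑ c, (∑ d, L a d * ∑' j : ℕ, W.R j d c) * ∑ d, (∑ e, L c e * ∑' j : ℕ, W.R j e d) * L d b :=
      sum_congr rfl fun c _ => by ring
    rw [hval] at h0
    refine h0.congr fun m => ?_
    rw [Finset.sum_div]
    simp only [Finset.sum_div]
    exact Finset.sum_comm
  have := hA.add hB
  rw [zero_add] at this
  refine this.congr fun m => ?_
  rw [S2_eq_conv W R₂ S₂ renS₂ m a b, add_div]

/-- Rank-one algebra: `(L R̄ L R̄ L)_{ab} = L_{ab} · θ²` with `θ = (L R̄ L)_{oo}/L_{oo}` (plumbing, from `Critical.L_mul_L_eq`).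
[cite: Seneta1973, §1.4; lane plumbing a-p2 g24] -/
theorem Critical.LRLRL_eq (h : K.Critical L) (Rb : Matrix ι ι ℝ) (o a b : ι) :
    (∑ c, (∑ d, L a d * Rb d c) * ∑ d, (∑ e, L c e * Rb e d) * L d b) =
      L a b * ((∑ d, (∑ c, L o c * Rb c d) * L d o) / L o o) ^ 2 := by
  have hoo := (h.pos o o).ne'
  -- `Σ_{c,d} L_{xc} Rb_{cd} L_{dy} = L_{xy} · τ`, `τ := Σ_{c,d} Rb_{cd} L_{dc}`
  set τ : ℝ := ∑ c, ∑ d, Rb c d * L d c with hτ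
  have key : ∀ x y', (∑ d, (∑ c, L x c * Rb c d) * L d y') = L x y' * τ := by
    intro x y'
    have e1 : ∀ d, (∑ c, L x c * Rb c d) * L d y' = ∑ c, L x y' * (Rb c d * L d c) := fun d => by
      rw [sum_mul]
      refine sum_congr rfl fun c _ => ?_
      have := h.L_mul_L_eq x c d y'
      calc L x c * Rb c d * L d y' = (L x c * L d y') * Rb c d := by ring
        _ = L x y' * L d c * Rb c d := by rw [this]
        _ = L x y' * (Rb c d * L d c) := by ring
    simp_rw [e1]
    rw [sum_comm, hτ, mul_sum]
    simp_rw [mul_sum]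
  have hθ : (∑ d, (∑ c, L o c * Rb c d) * L d o) / L o o = τ := by
    rw [key o o, mul_comm, mul_div_assoc, div_self hoo, mul_one]
  rw [hθ]
  have h2 : ∀ c, (∑ d, (∑ e, L c e * Rb e d) * L d b) = L c b * τ := fun c => key c b
  simp_rw [h2]
  have h3 : ∑ c, (∑ d, L a d * Rb d c) * (L c b * τ) = (∑ c, (∑ d, L a d * Rb d c) * L c b) * τ := by
    rw [sum_mul]
    exact sum_congr rfl fun c _ => by ring
  rw [h3, key a b]
  ring

/-- ★★★★ **`S₂(m)_{ab}/((m+1)² D(m)_{ab}) → θ²`**, `θ = (Σ_{c,d} L_{oc} R̄_{cd} L_{do})/L_{oo}` the reward density of the renewal–reward theorem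
(`RewardPair.tendsto_S_div_D`): the second moment of (reward)/(length) converges to the SQUARE of the first, for every pair of levels — so the variance
of the reward density of a sequence of total length `m` is `o(1)` (Chebyshev ⇒ weak law, assembled by the user from the explicit sums).  Hypotheses: the
one-piece reward has a finite SECOND moment (`R₂` summable). [cite: Feller1968, XIII.6; Seneta1973, §6.2; lane «pcv-sawmu» a-p2 g24 — own result] -/
theorem tendsto_S2_div_sq_D (h : K.Critical L) (W : RewardPair K) (R₂ S₂ : ℕ → Matrix ι ι ℝ) (hR₂ : ∀ j a b, 0 ≤ R₂ j a b)
    (hsR₂ : ∀ a b, Summable fun j => R₂ j a b)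
    (renS₂ : ∀ m, S₂ m = R₂ m + ∑ p ∈ antidiagonal m, (R₂ p.1 * K.D p.2 + (2 : ℝ) • (W.R p.1 * W.S p.2) + K.M p.1 * S₂ p.2)) (o a b : ι) :
    Tendsto (fun m : ℕ => S₂ m a b / (((m : ℝ) + 1) ^ 2 * K.D m a b)) atTop
      (𝓝 (((∑ d, (∑ c, L o c * ∑' j : ℕ, W.R j c d) * L d o) / L o o) ^ 2)) := by
  have h1 := tendsto_S2_div_sq h W R₂ S₂ hR₂ hsR₂ renS₂ a b
  rw [h.LRLRL_eq (fun d c => ∑' j : ℕ, W.R j d c) o a b] at h1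
  have h2 := K.tendsto_coeff h a b
  have hq := h1.div h2 (h.pos a b).ne'
  rw [mul_div_cancel_left₀ _ (h.pos a b).ne'] at hq
  refine hq.congr fun m => ?_
  simp only [Pi.div_apply]
  rw [div_div]

end RenewalKernelPair

end Literature.Probability.Process
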